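import Summits.AnomalousDissipation.AnomalousDissipation.Theorems.MirrorStatisticsLoudTG.Negative.LoadBearing
import Literature.Analysis.FluidPDE.LoopCirculation
import Literature.NumberTheory.UniformDistribution.EquidistributedModOnePi
import HarnessLib

/-!
# Tools for stub `stub_tubeLawSmoothK` (T2b) of line `regimes`
# (crux `MirrorEnsemble.MirrorStatisticsLoudTG`, stmt-AnomalousDissipation-17693): the tube profiles

The tube current of the skeleton loop `C = ∂([0,½]² × {x₂ = 0})` of the Taylor–Green force is
`g(x) = (η(x₂) ρ(x₀) ρ'(x₁), -η(x₂) ρ'(x₀) ρ(x₁), 0)` with smooth `1`-periodic profiles `ρ, η`, read in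
the fundamental-domain coordinates `Torus.repr x ∈ [0,1)³`. This file supplies its calculus on `T³`:

* `tube_coe_repr`, `tube_eta_repr_bound`, `tube_deriv_repr_bound` —
  localisation through the quotient norm of `ℝ/ℤ` (`‖t mod 1‖ ≤ |t|`,
  `UniformDistribution.norm_coe_le_abs`): `η(x₂) ≠ 0 ⇒ ‖x₂‖ ≤ δ` and
  `ρ'(xᵢ) ≠ 0 ⇒ xᵢ` lies within `2δ` of `{0, ½}`, as indicator bounds; `tube_weight_bound`,
  `tube_dweight_bound` — the resulting pointwise bounds `A²δ⁻² 𝟙(slabs)` on the components of `g`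
  and `A³δ⁻³ 𝟙(corners)` on their longitudinal derivatives.
* `tube_periodic_repr_proj`, `tube_lift_profile`, `tube_isSmooth_profile`, `tube_profile_line`,
  `tube_partialDeriv_zero_profile`, `tube_partialDeriv_one_profile`, `tube_isSmooth_current` —
  separable periodic profiles `c(x₂) a(x₀) b(x₁)` through `Torus.repr` lift to the plain products on
  `ℝ³`, hence are smooth on `T³` with `∂₀ = c a' b`, `∂₁ = c a b'`; the current `g` is smooth.
* `stub_tubeLawSmoothKTools2` — the registered tools sub-stub (conjunction of the above).

References: M. E. Brachet, D. I. Meiron, S. A. Orszag, B. G. Nickel, R. H. Morf, U. Frisch,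
*Small-scale structure of the Taylor–Green vortex*, J. Fluid Mech. 130 (1983) 411–452, §2 (mirror
symmetries of the TG vortex, the impermeable box `[0,½]³` and its edge skeleton)
[doi:10.1017/s0022112083001159]; L. Grafakos, *Classical Fourier Analysis*, 3rd ed. (2014), §3.1.1
(functions on `Tⁿ` as `1`-periodic functions on `ℝⁿ`) — folklore.
-/

-- every `Summit.AnomalousDissipation.AnomalousDissipation.…` name repeats the summit = problem segment (tree layout)
set_option linter.dupNamespace false

noncomputable section

namespace Summit.AnomalousDissipation.AnomalousDissipation.Theorems.MirrorEnsembleMirrorStatisticsLoudTG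

open MeasureTheory Filter Topology Set
open scoped ENNReal InnerProductSpace NNReal ContDiff
open Literature.Analysis.FunctionSpaces Literature.Analysis.FluidPDE Literature.NumberTheory

/-! ## Localisation of the profiles through the fundamental-domain coordinates -/

/-- The fundamental-domain coordinate represents the point: `↑(repr x i) = x i`. [folklore] -/
theorem tube_coe_repr (x : UnitAddTorus (Fin 3)) (i : Fin 3) :
    (((Torus.repr x) i : ℝ) : UnitAddCircle) = x i := by
  have h := congrFun (Torus.proj_repr x) i
  rwa [Torus.proj_apply] at h

/-- A profile `η` vanishing on `[δ, 1 - δ]` and bounded by `A/δ` satisfies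
`|η(repr x i)| ≤ (A/δ) 𝟙_{‖xᵢ‖ ≤ δ}`. [folklore] -/
theorem tube_eta_repr_bound {η : ℝ → ℝ} {A δ : ℝ} (hηb : ∀ t, |η t| ≤ A / δ)
    (hη0 : ∀ t, δ ≤ t → t ≤ 1 - δ → η t = 0) (x : UnitAddTorus (Fin 3)) (i : Fin 3) :
    |η (Torus.repr x i)| ≤ A / δ * {y : UnitAddTorus (Fin 3) | ‖y i‖ ≤ δ}.indicator 1 x := by
  by_cases hx : x ∈ {y : UnitAddTorus (Fin 3) | ‖y i‖ ≤ δ}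
  · rw [indicator_of_mem hx, Pi.one_apply, mul_one]
    exact hηb _
  · rw [indicator_of_notMem hx, mul_zero]
    have ht := Torus.repr_apply_mem_Ico x i
    have hn : ‖x i‖ = ‖((Torus.repr x i : ℝ) : UnitAddCircle)‖ := by rw [tube_coe_repr]
    simp only [mem_setOf_eq, not_le] at hx
    have h1 : δ ≤ Torus.repr x i := by
      by_contra h
      have : ‖x i‖ ≤ Torus.repr x i := by
        rw [hn]
        exact (UniformDistribution.norm_coe_le_abs _).trans (abs_of_nonneg ht.1).le
      linarith
    have h2 : Torus.repr x i ≤ 1 - δ := by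
      by_contra h
      have : ‖x i‖ ≤ 1 - Torus.repr x i := by
        rw [hn, show ((Torus.repr x i : ℝ) : UnitAddCircle) = ((Torus.repr x i - 1 : ℝ) : UnitAddCircle) by
          rw [AddCircle.coe_sub, AddCircle.coe_period, sub_zero]]
        refine (UniformDistribution.norm_coe_le_abs _).trans (le_of_eq ?_)
        rw [abs_of_nonpos (by linarith [ht.2]), neg_sub]
      linarith
    rw [hη0 _ h1 h2, abs_zero]

/-- A derivative profile `ρ'` bounded by `A/δ` whose support in `[0, 1]` lies in
`(δ, 2δ) ∪ (½ - 2δ, ½ - δ)` satisfies `|ρ'(repr x i)| ≤ (A/δ) (𝟙_{‖xᵢ‖ ≤ 2δ} + 𝟙_{‖xᵢ - ½‖ ≤ 2δ})`.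
[folklore] -/
theorem tube_deriv_repr_bound {ρ : ℝ → ℝ} {A δ : ℝ} (hAδ : 0 ≤ A / δ) (hρb : ∀ t, |deriv ρ t| ≤ A / δ)
    (hs : ∀ t, 0 ≤ t → t ≤ 1 → deriv ρ t ≠ 0 → (δ < t ∧ t < 2 * δ) ∨ (2⁻¹ - 2 * δ < t ∧ t < 2⁻¹ - δ))
    (x : UnitAddTorus (Fin 3)) (i : Fin 3) :
    |deriv ρ (Torus.repr x i)| ≤ A / δ * ({y : UnitAddTorus (Fin 3) | ‖y i‖ ≤ 2 * δ}.indicator 1 x +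
      {y : UnitAddTorus (Fin 3) | ‖y i - ((2⁻¹ : ℝ) : UnitAddCircle)‖ ≤ 2 * δ}.indicator 1 x) := by
  have hI0 : 0 ≤ {y : UnitAddTorus (Fin 3) | ‖y i‖ ≤ 2 * δ}.indicator (1 : UnitAddTorus (Fin 3) → ℝ) x :=
    Set.indicator_nonneg (fun _ _ => zero_le_one) x
  have hI1 : 0 ≤ {y : UnitAddTorus (Fin 3) |
      ‖y i - ((2⁻¹ : ℝ) : UnitAddCircle)‖ ≤ 2 * δ}.indicator (1 : UnitAddTorus (Fin 3) → ℝ) x :=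
    Set.indicator_nonneg (fun _ _ => zero_le_one) x
  by_cases h0 : deriv ρ (Torus.repr x i) = 0
  · rw [h0, abs_zero]
    exact mul_nonneg hAδ (add_nonneg hI0 hI1)
  · have ht := Torus.repr_apply_mem_Ico x i
    rcases hs _ ht.1 ht.2.le h0 with h | h
    · have hmem : x ∈ {y : UnitAddTorus (Fin 3) | ‖y i‖ ≤ 2 * δ} := by
        show ‖x i‖ ≤ 2 * δ
        rw [← tube_coe_repr x i]
        exact (UniformDistribution.norm_coe_le_abs _).trans (by rw [abs_of_nonneg ht.1]; exact h.2.le)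
      rw [indicator_of_mem hmem, Pi.one_apply]
      calc |deriv ρ (Torus.repr x i)| ≤ A / δ * (1 + 0) := by rw [add_zero, mul_one]; exact hρb _
        _ ≤ _ := mul_le_mul_of_nonneg_left (add_le_add_right hI1 1) hAδ
    · have hmem : x ∈ {y : UnitAddTorus (Fin 3) | ‖y i - ((2⁻¹ : ℝ) : UnitAddCircle)‖ ≤ 2 * δ} := by
        show ‖x i - ((2⁻¹ : ℝ) : UnitAddCircle)‖ ≤ 2 * δ
        rw [← tube_coe_repr x i, ← AddCircle.coe_sub]
        refine (UniformDistribution.norm_coe_le_abs _).trans ?_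
        rw [abs_le]
        constructor <;> linarith [h.1, h.2]
      rw [indicator_of_mem hmem, Pi.one_apply]
      calc |deriv ρ (Torus.repr x i)| ≤ A / δ * (0 + 1) := by rw [zero_add, mul_one]; exact hρb _
        _ ≤ _ := mul_le_mul_of_nonneg_left (add_le_add_left hI0 1) hAδ

/-- Pointwise bound on a tube-current component `η(x₂) c ρ'(x_l)` (`|c| ≤ 1`):
`|η(x₂)| |c| |ρ'(x_l)| ≤ A²δ⁻² 𝟙_{‖x₂‖≤δ} (𝟙_{‖x_l‖≤2δ} + 𝟙_{‖x_l-½‖≤2δ})`. [folklore] -/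
theorem tube_weight_bound {ρ η : ℝ → ℝ} {A δ c : ℝ} (hAδ : 0 ≤ A / δ) (hηb : ∀ t, |η t| ≤ A / δ)
    (hη0 : ∀ t, δ ≤ t → t ≤ 1 - δ → η t = 0) (hρb : ∀ t, |deriv ρ t| ≤ A / δ)
    (hs : ∀ t, 0 ≤ t → t ≤ 1 → deriv ρ t ≠ 0 → (δ < t ∧ t < 2 * δ) ∨ (2⁻¹ - 2 * δ < t ∧ t < 2⁻¹ - δ))
    (hc : |c| ≤ 1) (l : Fin 3) (x : UnitAddTorus (Fin 3)) :
    |η (Torus.repr x 2)| * |c| * |deriv ρ (Torus.repr x l)| ≤ A ^ 2 / δ ^ 2 *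
      ({y : UnitAddTorus (Fin 3) | ‖y 2‖ ≤ δ}.indicator 1 x *
        ({y : UnitAddTorus (Fin 3) | ‖y l‖ ≤ 2 * δ}.indicator 1 x +
          {y : UnitAddTorus (Fin 3) | ‖y l - ((2⁻¹ : ℝ) : UnitAddCircle)‖ ≤ 2 * δ}.indicator 1 x)) := by
  have I2 : 0 ≤ A / δ * {y : UnitAddTorus (Fin 3) | ‖y 2‖ ≤ δ}.indicator 1 x :=
    mul_nonneg hAδ (Set.indicator_nonneg (fun _ _ => zero_le_one) x)
  calc |η (Torus.repr x 2)| * |c| * |deriv ρ (Torus.repr x l)|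
      ≤ A / δ * {y : UnitAddTorus (Fin 3) | ‖y 2‖ ≤ δ}.indicator 1 x * 1 *
        (A / δ * ({y : UnitAddTorus (Fin 3) | ‖y l‖ ≤ 2 * δ}.indicator 1 x +
          {y : UnitAddTorus (Fin 3) | ‖y l - ((2⁻¹ : ℝ) : UnitAddCircle)‖ ≤ 2 * δ}.indicator 1 x)) :=
        mul_le_mul (mul_le_mul (tube_eta_repr_bound hηb hη0 x 2) hc (abs_nonneg _) I2)
          (tube_deriv_repr_bound hAδ hρb hs x l) (abs_nonneg _) (mul_nonneg I2 zero_le_one)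
    _ = _ := by ring

/-- Pointwise bound on the longitudinal derivative `η(x₂) ρ'(xₖ) ρ'(x_l)` of a tube-current component:
`≤ A³δ⁻³ 𝟙_{‖x₂‖≤δ} (𝟙_{‖x_l‖≤2δ} + 𝟙_{‖x_l-½‖≤2δ}) (𝟙_{‖xₖ‖≤2δ} + 𝟙_{‖xₖ-½‖≤2δ})` (a corner weight).
[folklore] -/
theorem tube_dweight_bound {ρ η : ℝ → ℝ} {A δ : ℝ} (hAδ : 0 ≤ A / δ) (hηb : ∀ t, |η t| ≤ A / δ)
    (hη0 : ∀ t, δ ≤ t → t ≤ 1 - δ → η t = 0) (hρb : ∀ t, |deriv ρ t| ≤ A / δ)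
    (hs : ∀ t, 0 ≤ t → t ≤ 1 → deriv ρ t ≠ 0 → (δ < t ∧ t < 2 * δ) ∨ (2⁻¹ - 2 * δ < t ∧ t < 2⁻¹ - δ))
    (k l : Fin 3) (x : UnitAddTorus (Fin 3)) :
    |η (Torus.repr x 2)| * |deriv ρ (Torus.repr x k)| * |deriv ρ (Torus.repr x l)| ≤ A ^ 3 / δ ^ 3 *
      ({y : UnitAddTorus (Fin 3) | ‖y 2‖ ≤ δ}.indicator 1 x *
        ({y : UnitAddTorus (Fin 3) | ‖y l‖ ≤ 2 * δ}.indicator 1 x +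
          {y : UnitAddTorus (Fin 3) | ‖y l - ((2⁻¹ : ℝ) : UnitAddCircle)‖ ≤ 2 * δ}.indicator 1 x) *
        ({y : UnitAddTorus (Fin 3) | ‖y k‖ ≤ 2 * δ}.indicator 1 x +
          {y : UnitAddTorus (Fin 3) | ‖y k - ((2⁻¹ : ℝ) : UnitAddCircle)‖ ≤ 2 * δ}.indicator 1 x)) := by
  have I2 : 0 ≤ A / δ * {y : UnitAddTorus (Fin 3) | ‖y 2‖ ≤ δ}.indicator 1 x :=
    mul_nonneg hAδ (Set.indicator_nonneg (fun _ _ => zero_le_one) x)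
  have Ik : 0 ≤ A / δ * ({y : UnitAddTorus (Fin 3) | ‖y k‖ ≤ 2 * δ}.indicator 1 x +
      {y : UnitAddTorus (Fin 3) | ‖y k - ((2⁻¹ : ℝ) : UnitAddCircle)‖ ≤ 2 * δ}.indicator 1 x) :=
    mul_nonneg hAδ (add_nonneg (Set.indicator_nonneg (fun _ _ => zero_le_one) x) (Set.indicator_nonneg (fun _ _ => zero_le_one) x))
  calc |η (Torus.repr x 2)| * |deriv ρ (Torus.repr x k)| * |deriv ρ (Torus.repr x l)|
      ≤ A / δ * {y : UnitAddTorus (Fin 3) | ‖y 2‖ ≤ δ}.indicator 1 x *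
        (A / δ * ({y : UnitAddTorus (Fin 3) | ‖y k‖ ≤ 2 * δ}.indicator 1 x +
          {y : UnitAddTorus (Fin 3) | ‖y k - ((2⁻¹ : ℝ) : UnitAddCircle)‖ ≤ 2 * δ}.indicator 1 x)) *
        (A / δ * ({y : UnitAddTorus (Fin 3) | ‖y l‖ ≤ 2 * δ}.indicator 1 x +
          {y : UnitAddTorus (Fin 3) | ‖y l - ((2⁻¹ : ℝ) : UnitAddCircle)‖ ≤ 2 * δ}.indicator 1 x)) :=
        mul_le_mul (mul_le_mul (tube_eta_repr_bound hηb hη0 x 2) (tube_deriv_repr_bound hAδ hρb hs x k)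
          (abs_nonneg _) I2) (tube_deriv_repr_bound hAδ hρb hs x l) (abs_nonneg _) (mul_nonneg I2 Ik)
    _ = _ := by ring

/-! ## Separable periodic profiles through `Torus.repr` are smooth on `T³` -/

/-- A `1`-periodic function does not see the lattice ambiguity of `repr ∘ proj`. [folklore] -/
theorem tube_periodic_repr_proj {f : ℝ → ℝ} (hf : Function.Periodic f 1) (z : EuclideanSpace ℝ (Fin 3))
    (i : Fin 3) : f (Torus.repr (Torus.proj z) i) = f (z i) := by
  obtain ⟨k, hk⟩ := Torus.exists_repr_proj_eq_add_latticeVec_holds (d := Fin 3) z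
  rw [hk, WithLp.ofLp_add, Pi.add_apply, Torus.latticeVec_apply]
  simpa using (hf.int_mul (k i)) (z i)

/-- The lift of the separable profile `x ↦ c(x₂) a(x₀) b(x₁)` (read in fundamental-domain coordinates)
is the plain product on `ℝ³`. [folklore] -/
theorem tube_lift_profile {a b c : ℝ → ℝ} (hpa : Function.Periodic a 1) (hpb : Function.Periodic b 1)
    (hpc : Function.Periodic c 1) :
    Torus.lift (fun x : UnitAddTorus (Fin 3) => c (Torus.repr x 2) * a (Torus.repr x 0) * b (Torus.repr x 1)) =
      fun z => c (z 2) * a (z 0) * b (z 1) := by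
  funext z
  simp only [Torus.lift_apply, tube_periodic_repr_proj hpa, tube_periodic_repr_proj hpb,
    tube_periodic_repr_proj hpc]

/-- Separable smooth periodic profiles are smooth on `T³`. [folklore] -/
theorem tube_isSmooth_profile {a b c : ℝ → ℝ} (ha : ContDiff ℝ (⊤ : ℕ∞) a) (hb : ContDiff ℝ (⊤ : ℕ∞) b)
    (hc : ContDiff ℝ (⊤ : ℕ∞) c) (hpa : Function.Periodic a 1) (hpb : Function.Periodic b 1)
    (hpc : Function.Periodic c 1) :
    Torus.IsSmooth (fun x : UnitAddTorus (Fin 3) =>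
      c (Torus.repr x 2) * a (Torus.repr x 0) * b (Torus.repr x 1)) := by
  unfold Torus.IsSmooth
  rw [tube_lift_profile hpa hpb hpc]
  have h : ∀ i : Fin 3, ContDiff ℝ (⊤ : ℕ∞) (fun z : EuclideanSpace ℝ (Fin 3) => z i) := fun i =>
    contDiff_piLp_apply (p := 2)
  exact ((hc.comp (h 2)).mul (ha.comp (h 0))).mul (hb.comp (h 1))

/-- The line through `x = proj (repr x)` in direction `eᵢ` read on the separable profile. [folklore] -/
theorem tube_profile_line {a b c : ℝ → ℝ} (hpa : Function.Periodic a 1) (hpb : Function.Periodic b 1)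
    (hpc : Function.Periodic c 1) (x : UnitAddTorus (Fin 3)) (i : Fin 3) (t : ℝ) :
    c (Torus.repr (x + Torus.proj (t • EuclideanSpace.single i 1)) 2) *
        a (Torus.repr (x + Torus.proj (t • EuclideanSpace.single i 1)) 0) *
        b (Torus.repr (x + Torus.proj (t • EuclideanSpace.single i 1)) 1) =
      c (Torus.repr x 2 + if (2 : Fin 3) = i then t else 0) *
        a (Torus.repr x 0 + if (0 : Fin 3) = i then t else 0) *
        b (Torus.repr x 1 + if (1 : Fin 3) = i then t else 0) := by
  have h := congrFun (tube_lift_profile hpa hpb hpc (a := a) (b := b) (c := c))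
    (Torus.repr x + t • EuclideanSpace.single i 1)
  rw [Torus.lift_apply, Torus.proj_add, Torus.proj_repr] at h
  rw [h]
  simp

/-- `∂₀ (c(x₂) a(x₀) b(x₁)) = c(x₂) a'(x₀) b(x₁)`. [folklore] -/
theorem tube_partialDeriv_zero_profile {a b c : ℝ → ℝ} (ha : ContDiff ℝ (⊤ : ℕ∞) a)
    (hpa : Function.Periodic a 1) (hpb : Function.Periodic b 1) (hpc : Function.Periodic c 1)
    (x : UnitAddTorus (Fin 3)) :
    Torus.partialDeriv 0 (fun x : UnitAddTorus (Fin 3) =>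
        c (Torus.repr x 2) * a (Torus.repr x 0) * b (Torus.repr x 1)) x =
      c (Torus.repr x 2) * deriv a (Torus.repr x 0) * b (Torus.repr x 1) := by
  simp only [Torus.partialDeriv, Torus.lineDeriv, tube_profile_line hpa hpb hpc]
  have h0 : HasDerivAt a (deriv a (Torus.repr x 0 + 0)) (Torus.repr x 0 + 0) :=
    ((ha.differentiable (by simp)) _).hasDerivAt
  have hda := h0.comp_const_add (Torus.repr x 0) 0
  rw [add_zero] at hda
  have h := ((hda.const_mul (c (Torus.repr x 2))).mul_const (b (Torus.repr x 1))).deriv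
  simpa using h

/-- `∂₁ (c(x₂) a(x₀) b(x₁)) = c(x₂) a(x₀) b'(x₁)`. [folklore] -/
theorem tube_partialDeriv_one_profile {a b c : ℝ → ℝ} (hb : ContDiff ℝ (⊤ : ℕ∞) b)
    (hpa : Function.Periodic a 1) (hpb : Function.Periodic b 1) (hpc : Function.Periodic c 1)
    (x : UnitAddTorus (Fin 3)) :
    Torus.partialDeriv 1 (fun x : UnitAddTorus (Fin 3) =>
        c (Torus.repr x 2) * a (Torus.repr x 0) * b (Torus.repr x 1)) x =
      c (Torus.repr x 2) * a (Torus.repr x 0) * deriv b (Torus.repr x 1) := by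
  simp only [Torus.partialDeriv, Torus.lineDeriv, tube_profile_line hpa hpb hpc]
  have h0 : HasDerivAt b (deriv b (Torus.repr x 1 + 0)) (Torus.repr x 1 + 0) :=
    ((hb.differentiable (by simp)) _).hasDerivAt
  have hdb := h0.comp_const_add (Torus.repr x 1) 0
  rw [add_zero] at hdb
  have h := (hdb.const_mul (c (Torus.repr x 2) * a (Torus.repr x 0))).deriv
  simpa using h

/-- The tube current `g = (η(x₂)ρ(x₀)ρ'(x₁), -η(x₂)ρ'(x₀)ρ(x₁), 0)` of smooth `1`-periodic profiles,
read in fundamental-domain coordinates, is a smooth vector field on `T³`. [folklore] -/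
theorem tube_isSmooth_current {ρ η : ℝ → ℝ} (hρ : ContDiff ℝ (⊤ : ℕ∞) ρ) (hη : ContDiff ℝ (⊤ : ℕ∞) η)
    (hpρ : Function.Periodic ρ 1) (hpη : Function.Periodic η 1) :
    Torus.IsSmooth (fun y : UnitAddTorus (Fin 3) =>
      !₂[η (Torus.repr y 2) * ρ (Torus.repr y 0) * deriv ρ (Torus.repr y 1),
         -(η (Torus.repr y 2) * deriv ρ (Torus.repr y 0) * ρ (Torus.repr y 1)), (0 : ℝ)]) := by
  have hdρ : ContDiff ℝ (⊤ : ℕ∞) (deriv ρ) := (contDiff_infty_iff_deriv.1 hρ).2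
  have hpdρ : Function.Periodic (deriv ρ) 1 := hpρ.deriv
  have h0 := tube_isSmooth_profile hρ hdρ hη hpρ hpdρ hpη
  have h1 := tube_isSmooth_profile hdρ hρ hη hpdρ hpρ hpη
  unfold Torus.IsSmooth at h0 h1 ⊢
  simp only [Torus.lift, Function.comp_def] at h0 h1 ⊢
  refine contDiff_piLp' 2 fun i => ?_
  fin_cases i
  · simpa using h0
  · simpa using h1.neg
  · simp [contDiff_const]

/-! ## The registered tools sub-stub -/

/-- **Tools sub-stub `stub_tubeLawSmoothKTools2`** of `stub_tubeLawSmoothK` (line `regimes`, crux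
stmt-AnomalousDissipation-17693): the conjunction of the top-level profile lemmas of this file (the pointwise
weight bounds, smoothness and partial derivatives of separable periodic profiles through `Torus.repr`,
smoothness of the tube current; the localisation and lifting lemmas enter through them). [folklore] -/
theorem stub_tubeLawSmoothKTools2 :
    (∀ {ρ η : ℝ → ℝ} {A δ c : ℝ} (hAδ : 0 ≤ A / δ) (hηb : ∀ t, |η t| ≤ A / δ) (hη0 : ∀ t, δ ≤ t → t
      ≤ 1 - δ → η t = 0) (hρb : ∀ t, |deriv ρ t| ≤ A / δ) (hs : ∀ t, 0 ≤ t → t ≤ 1 → deriv ρ t ≠ 0 →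
      (δ < t ∧ t < 2 * δ) ∨ (2⁻¹ - 2 * δ < t ∧ t < 2⁻¹ - δ)) (hc : |c| ≤ 1) (l : Fin 3) (x :
      UnitAddTorus (Fin 3)), |η (Torus.repr x 2)| * |c| * |deriv ρ (Torus.repr x l)| ≤ A ^ 2 / δ ^ 2
      * ({y : UnitAddTorus (Fin 3) | ‖y 2‖ ≤ δ}.indicator 1 x * ({y : UnitAddTorus (Fin 3) | ‖y l‖ ≤
      2 * δ}.indicator 1 x + {y : UnitAddTorus (Fin 3) | ‖y l - ((2⁻¹ : ℝ) : UnitAddCircle)‖ ≤ 2 *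
      δ}.indicator 1 x))) ∧
    (∀ {ρ η : ℝ → ℝ} {A δ : ℝ} (hAδ : 0 ≤ A / δ) (hηb : ∀ t, |η t| ≤ A / δ) (hη0 : ∀ t, δ ≤ t → t ≤
      1 - δ → η t = 0) (hρb : ∀ t, |deriv ρ t| ≤ A / δ) (hs : ∀ t, 0 ≤ t → t ≤ 1 → deriv ρ t ≠ 0 →
      (δ < t ∧ t < 2 * δ) ∨ (2⁻¹ - 2 * δ < t ∧ t < 2⁻¹ - δ)) (k l : Fin 3) (x : UnitAddTorus (Fin
      3)), |η (Torus.repr x 2)| * |deriv ρ (Torus.repr x k)| * |deriv ρ (Torus.repr x l)| ≤ A ^ 3 /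
      δ ^ 3 * ({y : UnitAddTorus (Fin 3) | ‖y 2‖ ≤ δ}.indicator 1 x * ({y : UnitAddTorus (Fin 3) |
      ‖y l‖ ≤ 2 * δ}.indicator 1 x + {y : UnitAddTorus (Fin 3) | ‖y l - ((2⁻¹ : ℝ) : UnitAddCircle)‖
      ≤ 2 * δ}.indicator 1 x) * ({y : UnitAddTorus (Fin 3) | ‖y k‖ ≤ 2 * δ}.indicator 1 x + {y :
      UnitAddTorus (Fin 3) | ‖y k - ((2⁻¹ : ℝ) : UnitAddCircle)‖ ≤ 2 * δ}.indicator 1 x))) ∧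
    (∀ {a b c : ℝ → ℝ} (ha : ContDiff ℝ (⊤ : ℕ∞) a) (hb : ContDiff ℝ (⊤ : ℕ∞) b) (hc : ContDiff ℝ (⊤
      : ℕ∞) c) (hpa : Function.Periodic a 1) (hpb : Function.Periodic b 1) (hpc : Function.Periodic
      c 1), Torus.IsSmooth (fun x : UnitAddTorus (Fin 3) => c (Torus.repr x 2) * a (Torus.repr x 0)
      * b (Torus.repr x 1))) ∧
    (∀ {a b c : ℝ → ℝ} (ha : ContDiff ℝ (⊤ : ℕ∞) a) (hpa : Function.Periodic a 1) (hpb :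
      Function.Periodic b 1) (hpc : Function.Periodic c 1) (x : UnitAddTorus (Fin 3)),
      Torus.partialDeriv 0 (fun x : UnitAddTorus (Fin 3) => c (Torus.repr x 2) * a (Torus.repr x 0)
      * b (Torus.repr x 1)) x = c (Torus.repr x 2) * deriv a (Torus.repr x 0) * b (Torus.repr x 1)) ∧
    (∀ {a b c : ℝ → ℝ} (hb : ContDiff ℝ (⊤ : ℕ∞) b) (hpa : Function.Periodic a 1) (hpb :
      Function.Periodic b 1) (hpc : Function.Periodic c 1) (x : UnitAddTorus (Fin 3)),
      Torus.partialDeriv 1 (fun x : UnitAddTorus (Fin 3) => c (Torus.repr x 2) * a (Torus.repr x 0)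
      * b (Torus.repr x 1)) x = c (Torus.repr x 2) * a (Torus.repr x 0) * deriv b (Torus.repr x 1)) ∧
    (∀ {ρ η : ℝ → ℝ} (hρ : ContDiff ℝ (⊤ : ℕ∞) ρ) (hη : ContDiff ℝ (⊤ : ℕ∞) η) (hpρ :
      Function.Periodic ρ 1) (hpη : Function.Periodic η 1), Torus.IsSmooth (fun y : UnitAddTorus
      (Fin 3) => !₂[η (Torus.repr y 2) * ρ (Torus.repr y 0) * deriv ρ (Torus.repr y 1), -(η
      (Torus.repr y 2) * deriv ρ (Torus.repr y 0) * ρ (Torus.repr y 1)), (0 : ℝ)])) :=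
  ⟨tube_weight_bound, tube_dweight_bound, tube_isSmooth_profile, tube_partialDeriv_zero_profile,
    tube_partialDeriv_one_profile, tube_isSmooth_current⟩

end Summit.AnomalousDissipation.AnomalousDissipation.Theorems.MirrorEnsembleMirrorStatisticsLoudTG

end
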